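import Mathlib
import Literature.Barriers.PneNP.ExtendedFormulationMinkowskiFaces
import Literature.Barriers.PneNP.ExtendedFormulationLinearImage
import Literature.Barriers.PneNP.CorrelationPolytopeXCLowerBoundGraph

/-!
# Sketch — val-idea-38 g1 (WAVE-5 seat W5-P2, crux stmt-ValiantsHypothesis-21181, residual COR-VIRTUAL)

Card `switched-face-kills-towers`: the SWITCHED COORDINATE FACE `F_a = conv{bbᵀ : b_a = 1} ≅ COR(K_{h−1})` of `COR(K_h)`
has a SEMIDEFINITE-FREE direction space `lin F_a = {D = Dᵀ : D_aa = 0, D_pp = D_pa (p ≠ a)}`; hence a located-POINT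
certificate at `F_a` (one functional `C` valid on COR, tight exactly on `F_a`, with a unique maximising passenger point)
decides EVERY passenger whose generators / edge directions are (±) positive semidefinite — all 0-1 rank-one towers
(`Z_full`, `Z_{h/2}`, `Z_s`, budgeted truncations, `Σ_b [α_b,β_b]·bbᵀ`), real rank-one and PSD-generated zonotopes, `±M·COR`,
`COR − COR` — UNCONDITIONALLY at rate `xc ≥ xc(COR(K_{h−1})) ≥ 1.5^{h−1}` (the line had them only in class K, modulo KMR).
Statements + finite sanity checks only (planner).  VP ≠ VNP NOT proved; `NNDivisionHard` NOT proved; COR-VIRTUAL OPEN.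
-/

set_option autoImplicit false
set_option linter.dupNamespace false

noncomputable section

open Matrix Finset
open scoped Pointwise

namespace Summit.ValiantsHypothesis.ValiantsHypothesis.Cruxes.NNDivisionHard.SwitchFace

open Literature.Barriers.PneNP (HasEFOfSize)
open Literature.Combinatorics.Optimization (corPolytopeGraph corVec)
/-- a 0/1 rank-one TOWER `Σ_{b : P b} [−1,1] · λ_b · b bᵀ` (verbatim copy of `…Cruxes.NNDivisionHard.PairFace.tower`, idea-38 g0 rev 5). -/
def tower (h : ℕ) (P : (Fin h → Bool) → Prop) [DecidablePred P] (lam : (Fin h → Bool) → ℝ) : Set (Fin h × Fin h → ℝ) :=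
  convexHull ℝ (Set.range fun ε : (Fin h → Bool) → Bool =>
    ∑ b : Fin h → Bool, if P b then ((if ε b then (1 : ℝ) else -1) * lam b) • corVec ⊤ b else 0)

/-- a zonotope given by a finite generator list (verbatim copy of `…PairFace.zonotopeOf`). -/
def zonotopeOf {ι : Type} (G : ℕ) (gen : Fin G → (ι → ℝ)) : Set (ι → ℝ) :=
  convexHull ℝ (Set.range fun ε : Fin G → Bool => ∑ g, (if ε g then (1 : ℝ) else -1) • gen g)

/-! ## §1 The switched coordinate face `F_a` and its explicit exposing direction -/

/-- ★ the TOWER-GENERIC switching direction `C^{(a)}_M`: `C_aa = M`, `C_ap = C_pa = 1`, `C_pp = −2` (`p ≠ a`), `0` elsewhere.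
As a quadratic pseudo-Boolean function `f(b) = Σ C_pq b_p b_q = M·b_a − 2·(1 − b_a)·|b ∖ {a}|`:
`= M` iff `b_a = 1`, `= −2|b| ≤ 0` otherwise — valid for `M > 0`, tight EXACTLY on `F_a`, and NONZERO on every `bbᵀ`, `b ≠ 0`. -/
def switchDir (n : ℕ) (a : Fin n) (M : ℝ) : Fin n × Fin n → ℝ := fun pq =>
  if pq.1 = a ∧ pq.2 = a then M
  else if pq.1 = a ∨ pq.2 = a then 1
  else if pq.1 = pq.2 then -2 else 0

/-- the switched coordinate face `F_a := conv{bbᵀ : b_a = 1}` of `COR(K_n)` (affinely `≅ COR(K_{n−1})`: `(e_a + e)(e_a + e)ᵀ ↦ eeᵀ`). -/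
def faceFix (n : ℕ) (a : Fin n) : Set (Fin n × Fin n → ℝ) :=
  convexHull ℝ (Set.range fun b : {b : Fin n → Bool // b a = true} => corVec (⊤ : SimpleGraph (Fin n)) b.1)

/-- the DELETION READ `x ↦ (x_{ιp, ιq})_{p,q}`, `ι = a.succAbove`: linear, maps `F_a` onto `COR(K_{n})` (index `a` forgotten). -/
def delRead (n : ℕ) (a : Fin (n + 1)) : (Fin (n + 1) × Fin (n + 1) → ℝ) →ₗ[ℝ] (Fin n × Fin n → ℝ) :=
  LinearMap.funLeft ℝ ℝ fun pq : Fin n × Fin n => (a.succAbove pq.1, a.succAbove pq.2)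

/-- S1 — value of `C^{(a)}_M` on the vertices of COR: `M` on `F_a`, `−2|b|` off it. -/
def SwitchDirValue : Prop :=
  ∀ (n : ℕ) (a : Fin n) (M : ℝ) (b : Fin n → Bool),
    switchDir n a M ⬝ᵥ corVec ⊤ b =
      if b a = true then M else -2 * ((Finset.univ.filter fun p => b p = true).card : ℝ)

/-- S2 — hence (`M > 0`): valid, tight exactly on `F_a`, and nonzero on every nonzero 0-1 rank-one generator `bbᵀ`. -/
def SwitchDirFace : Prop :=
  ∀ (n : ℕ) (a : Fin n) (M : ℝ), 0 < M → ∀ b : Fin n → Bool,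
    switchDir n a M ⬝ᵥ corVec ⊤ b ≤ M ∧ (switchDir n a M ⬝ᵥ corVec ⊤ b = M ↔ b a = true) ∧
      ((∃ p, b p = true) → switchDir n a M ⬝ᵥ corVec ⊤ b ≠ 0)

/-- S3 — the face of COR cut out by `C^{(a)}_M` IS `F_a`, and the deletion read maps `F_a` onto `COR(K_n)`. -/
def FaceFixRead : Prop :=
  ∀ (n : ℕ) (a : Fin (n + 1)) (M : ℝ), 0 < M →
    corPolytopeGraph (⊤ : SimpleGraph (Fin (n + 1))) ∩ {x | switchDir (n + 1) a M ⬝ᵥ x = M} = faceFix (n + 1) a ∧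
    delRead n a '' faceFix (n + 1) a = corPolytopeGraph (⊤ : SimpleGraph (Fin n))

/-! ## §2 The located-POINT certificate at `F_a` (the class, typed by `∃ C`, not by vertex differences) -/

/-- ★ CLASS `SwitchExposed`: some index `a` and some functional `C`, valid on `COR(K_{n+1})` and tight exactly on `F_a`, have a
UNIQUE maximising passenger point (ties only between equal points).  This is the located-point form; the line's E / 40's `hsep` quantify
over vertex DIFFERENCES instead and miss every tower (`2E^s_{pq} ∈ lin F_a` IS a vertex difference of `Z_full`, cf. §4). -/
def SwitchExposed (n : ℕ) {K : ℕ} (q : Fin (K + 1) → (Fin (n + 1) × Fin (n + 1) → ℝ)) : Prop :=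
  ∃ (a : Fin (n + 1)) (C : Fin (n + 1) × Fin (n + 1) → ℝ) (M : ℝ),
    (∀ b : Fin (n + 1) → Bool, C ⬝ᵥ corVec ⊤ b ≤ M) ∧ (∀ b : Fin (n + 1) → Bool, C ⬝ᵥ corVec ⊤ b = M ↔ b a = true) ∧
      ∃ j₀, ∀ j, C ⬝ᵥ q j < C ⬝ᵥ q j₀ ∨ q j = q j₀

/-- ★★ **SWITCHED-FACE RUNG** (the certificate): a switch-exposed passenger leaves `COR(K_{n+1}) + Q` at least as hard as `COR(K_n)`.
Proof route: `face_C(COR + Q) = F_a + {q_{j₀}}` (`HasEFOfSize.face_add_face₁` + S3 + the hull of the maximisers), translate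
(`image_add_const`), read (`image_linearMap delRead`, S3). -/
def SwitchedFaceRung : Prop :=
  ∀ (n K : ℕ) (q : Fin (K + 1) → (Fin (n + 1) × Fin (n + 1) → ℝ)) (r : ℕ), SwitchExposed n q →
    HasEFOfSize (corPolytopeGraph (⊤ : SimpleGraph (Fin (n + 1))) + convexHull ℝ (Set.range q)) r →
      HasEFOfSize (corPolytopeGraph (⊤ : SimpleGraph (Fin n))) r

/-- ★★ **TOWER RUNG** (headline instance, explicit direction `C^{(a)}_1`, no genericity): for EVERY 0-1 rank-one tower
`Z = Σ_{P b} [−1,1]·λ_b·bbᵀ` (any sub-family, any weights — `Z_full`, `Z_{h/2}`, `Z_s`, truncations),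
`xc(COR(K_{n+1}) + Z) ≥ xc(COR(K_n))`.  (`C^{(a)}_1 · bbᵀ ∈ {1, −2|b|} ≠ 0`, so `face_C(Z)` is the single vertex `Σ sign·λ_b bbᵀ`.) -/
def TowerSwitchRung : Prop :=
  ∀ (n : ℕ) (P : (Fin (n + 1) → Bool) → Prop) [DecidablePred P] (lam : (Fin (n + 1) → Bool) → ℝ) (r : ℕ),
    HasEFOfSize (corPolytopeGraph (⊤ : SimpleGraph (Fin (n + 1))) + tower (n + 1) P lam) r →
      HasEFOfSize (corPolytopeGraph (⊤ : SimpleGraph (Fin n))) r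

/-- COROLLARY (glue shown): towers are decided UNCONDITIONALLY at Kaibel–Weltge rate `3^n ≤ (r+1)·2^n` on `K_{n+1}` —
no `MaxCutLPHard` (KMR), no budget. -/
theorem tower_three_pow_le (hT : TowerSwitchRung) (n : ℕ) (P : (Fin (n + 1) → Bool) → Prop) [DecidablePred P]
    (lam : (Fin (n + 1) → Bool) → ℝ) (r : ℕ)
    (h : HasEFOfSize (corPolytopeGraph (⊤ : SimpleGraph (Fin (n + 1))) + tower (n + 1) P lam) r) :
    3 ^ n ≤ (r + 1) * 2 ^ n :=
  Literature.Barriers.PneNP.corPolytopeGraph_top_three_pow_le (hT n P lam r h)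

/-! ## §3 Why it reaches all SEMIDEFINITE-edged passengers: `lin F_a` is PSD-free -/

/-- membership in `lin F_a = aff F_a − x₀ = {D symmetric : D_aa = 0, D_pp = D_pa ∀ p ≠ a}` (dimension `n(n−1)/2 = dim COR(K_{n−1})`). -/
def FixAligned {n : ℕ} (a : Fin n) (D : Fin n × Fin n → ℝ) : Prop :=
  (∀ p q, D (p, q) = D (q, p)) ∧ D (a, a) = 0 ∧ ∀ p, p ≠ a → D (p, p) = D (p, a)

/-- Gram / positive-semidefinite vectors `g_pq = ⟨v_p, v_q⟩`. -/
def IsGram {n : ℕ} (g : Fin n × Fin n → ℝ) : Prop :=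
  ∃ (k : ℕ) (v : Fin n → Fin k → ℝ), ∀ p q, g (p, q) = ∑ i, v p i * v q i

/-- S4 — **PSD-FREENESS**: a nonzero Gram vector is never `F_a`-aligned (`g_aa = |v_a|² = 0 ⇒ v_a = 0 ⇒ g_pa = 0 ⇒ g_pp = |v_p|² = 0`).
(For the unswitched face `{b_a = 0}` this FAILS: `lin = Sym([n]∖a) ∋ E_pp` — the switch is what couples the diagonal to the `a`-row.) -/
def PSDFree : Prop :=
  ∀ (n : ℕ) (a : Fin n) (g : Fin n × Fin n → ℝ), IsGram g → FixAligned a g → g = 0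

/-- S5 — GENERIC DIRECTION in `relint N(F_a)` (40's `exists_generic_comb` pattern): the normal cone of `F_a` is the open set
`{C : C_aa = M, C_pp = −2C_pa = c_p (p ≠ a), C_pq = 0 otherwise, M > Σ_p max(c_p,0)}` (+ antisymmetric parts); finitely many
non-aligned symmetric generators are simultaneously avoided. -/
def GenericSwitchDir : Prop :=
  ∀ (n : ℕ) (a : Fin (n + 1)) (G : ℕ) (gen : Fin G → (Fin (n + 1) × Fin (n + 1) → ℝ)),
    (∀ g, (∀ p q, gen g (p, q) = gen g (q, p)) ∧ (gen g ≠ 0 → ¬ FixAligned a (gen g))) →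
      ∃ (C : Fin (n + 1) × Fin (n + 1) → ℝ) (M : ℝ),
        (∀ b : Fin (n + 1) → Bool, C ⬝ᵥ corVec ⊤ b ≤ M) ∧ (∀ b : Fin (n + 1) → Bool, C ⬝ᵥ corVec ⊤ b = M ↔ b a = true) ∧
          ∀ g, gen g ≠ 0 → C ⬝ᵥ gen g ≠ 0

/-- ★★ **PSD-ZONOTOPE RUNG**: every zonotope whose generators are each positive OR negative semidefinite — real rank-one towers
`Σ [−1,1] v_i v_iᵀ`, `Z_full`, Gram zonotopes — satisfies `xc(COR(K_{n+1}) + Z) ≥ xc(COR(K_n))`.  (S4 + S5 + the zonotope vertex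
lemma `face_C(Z) = {Σ sign(C·g) g}` when all `C·g ≠ 0` + the rung.) -/
def PSDZonotopeRung : Prop :=
  ∀ (n G : ℕ) (gen : Fin G → (Fin (n + 1) × Fin (n + 1) → ℝ)) (r : ℕ),
    (∀ g, IsGram (gen g) ∨ IsGram (-gen g)) →
      HasEFOfSize (corPolytopeGraph (⊤ : SimpleGraph (Fin (n + 1))) + zonotopeOf G gen) r →
        HasEFOfSize (corPolytopeGraph (⊤ : SimpleGraph (Fin n))) r

/-- ★ **DIFFERENCE BODY** `COR − COR` (listed by idea-43 / crit-9 as a member of K only, i.e. decided mod KMR): the explicit `C^{(a)}_1`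
has the UNIQUE minimiser `b = univ ∖ {a}` on `{0,1}^{n+1}` (value `−2n`; F5), so `face_C(−COR)` is a vertex, `face_C(COR − COR) = F_a − pt`,
and `xc(COR(K_{n+1}) − COR(K_{n+1})) ≥ xc(COR(K_n))`; the same for `COR + (−λ·COR)`, `λ > 0`. -/
def CorMinusCorRung : Prop :=
  ∀ (n r : ℕ), HasEFOfSize (corPolytopeGraph (⊤ : SimpleGraph (Fin (n + 1))) +
      (-corPolytopeGraph (⊤ : SimpleGraph (Fin (n + 1))))) r →
    HasEFOfSize (corPolytopeGraph (⊤ : SimpleGraph (Fin n))) r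

/-! ## §4 Cheapest falsifiers, run in-Lean (integer mirrors, `n = 5`) -/

/-- integer mirror of `C^{(a)}_M`. -/
def switchDirZ (n : ℕ) (a : Fin n) (M : ℤ) : Fin n × Fin n → ℤ := fun pq =>
  if pq.1 = a ∧ pq.2 = a then M
  else if pq.1 = a ∨ pq.2 = a then 1
  else if pq.1 = pq.2 then -2 else 0

/-- `f_C(b) = Σ_{p,q} C_pq b_p b_q`. -/
def fZ (n : ℕ) (a : Fin n) (M : ℤ) (b : Fin n → Bool) : ℤ :=
  ∑ p : Fin n, ∑ q : Fin n, if b p && b q then switchDirZ n a M (p, q) else 0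

/-- (F1) S1/S2 at `n = 5`, every `a`, `M = 1`: value formula, tight set = `{b_a = 1}`, nonzero off `b = 0`. -/
example : ∀ a : Fin 5, ∀ b : Fin 5 → Bool,
    fZ 5 a 1 b = (if b a then 1 else -2 * ((Finset.univ.filter fun p => b p = true).card : ℤ)) ∧
    fZ 5 a 1 b ≤ 1 ∧ (fZ 5 a 1 b = 1 ↔ b a = true) ∧ ((∃ p, b p = true) → fZ 5 a 1 b ≠ 0) := by
  native_decide

/-- (F5) `−COR` / `COR − COR` with the SAME explicit direction: `f_{C^{(a)}_1}` has the unique minimiser `b = univ ∖ {a}` (value `−2n`)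
on `{0,1}^{n+1}`, `n + 1 = 5`, all `a` — so `face_C(−COR)` is a vertex and no genericity is needed for the difference body either. -/
example : ∀ a : Fin 5, ∀ b : Fin 5 → Bool, -8 ≤ fZ 5 a 1 b ∧ (fZ 5 a 1 b = -8 ↔ b = fun p => decide (p ≠ a)) := by
  native_decide

/-- (F2) the MISS of the difference-typed hypothesis: `2·E^s_{pq}` (`p, q ≠ a`) is `F_a`-aligned (it is the vertex difference
`(g_{pq} − g_p − g_q)·2` of `Z_full`), so `hsep` / class E typed on vertex differences cannot certify `Z_full` — while no single
GENERATOR `bbᵀ ≠ 0` is aligned (F1: `f_C(b) ≠ 0`).  Checked at `n = 5`, `a = 0`, `(p,q) = (1,2)`. -/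
example : FixAligned (n := 5) 0 (fun pq : Fin 5 × Fin 5 =>
    if (pq.1 = 1 ∧ pq.2 = 2) ∨ (pq.1 = 2 ∧ pq.2 = 1) then (2 : ℝ) else 0) := by
  refine ⟨?_, ?_, ?_⟩
  · intro p q; fin_cases p <;> fin_cases q <;> simp
  · simp
  · intro p hp; fin_cases p <;> simp_all

/-- (F3) PSD-freeness on the 0-1 rank-ones at `n = 5`: `bbᵀ` is `F_a`-aligned only for `b = 0` (all `a`). -/
example : ∀ a : Fin 5, ∀ b : Fin 5 → Bool,
    ((b a && b a) = false ∧ ∀ p : Fin 5, p ≠ a → (b p && b p) = (b p && b a)) → ∀ p, b p = false := by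
  native_decide

/-- (F4) `COR − COR`: for the generic-type direction `c = (M; c_p) = (7; −1, 2, −3, 1)` at `n = 5`, `a = 0`, the minimum of `f_c` over
`{0,1}^5` is attained at exactly one point. -/
def cZ : Fin 5 × Fin 5 → ℤ := fun pq =>
  let c : Fin 5 → ℤ := ![7, -1, 2, -3, 1]
  if pq.1 = 0 ∧ pq.2 = 0 then 7
  else if pq.1 = 0 then -(c pq.2)       -- C_ap = −c_p/2 doubled below via symmetric counting: use C_ap + C_pa = −c_p
  else if pq.2 = 0 then 0
  else if pq.1 = pq.2 then c pq.1 else 0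

def gZ (b : Fin 5 → Bool) : ℤ := ∑ p : Fin 5, ∑ q : Fin 5, if b p && b q then cZ (p, q) else 0

example : (∀ b : Fin 5 → Bool, gZ b ≤ 7 ∧ (gZ b = 7 ↔ b 0 = true)) ∧
    (Finset.univ.filter fun b : Fin 5 → Bool => ∀ b', gZ b ≤ gZ b').card = 1 := by
  native_decide

end Summit.ValiantsHypothesis.ValiantsHypothesis.Cruxes.NNDivisionHard.SwitchFace

end
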